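import Literature.AlgebraicGeometry.Modules.CechPicFrobeniusPullback
import Literature.AlgebraicGeometry.AbelianSchemes.DualIsogenyMulN
import Literature.AlgebraicGeometry.AbelianSchemes.AbelianSchemeDualIsogenyComp
import Literature.AlgebraicGeometry.AbelianSchemes.AbelianSchemeDualIsogenyHom
import Literature.AlgebraicGeometry.AbelianSchemes.AbelianSchemeDualTransportOfBaseChange
import Literature.AlgebraicGeometry.AbelianSchemes.AbelianSchemeOverField
import Literature.AlgebraicGeometry.Motives.AbelianVarietyVerschiebung
import Literature.AlgebraicGeometry.Motives.AbelianVarietyTorsion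
import HarnessLib

/-!
# The dual of the relative Frobenius is the Verschiebung: `F_{Â} ≫ (F_A)^∨ = [q]_{Â}`, `(F_A)^∨ = V_{Â}`
# ([MumfordAV1970] §15 Thm. 1; [Oda1969] §1; EGM (5.21)∕(7.34)) — organ (DF) of the P6 HEART

Layer `Literature/AlgebraicGeometry/AbelianSchemes`, namespace
`Literature.AlgebraicGeometry.AbelianSchemes.AbelianSchemeOver.DualPair`.  Cell `hodgecm-mathlib`, programme P6 (MOD):
the A-lane organ **(DF)** of desk F0P6d-plan's ST1-CUT v1 §1 and desk F0P6a-plan's HEART-FROB §B (1) («`ψ^*λ^{(q)} = λ`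
uses `F_A^∨ λ^{(q)} F_A = qλ`»), in the split with A-p17 (g24) ((DF-1)+(DF-2) here; the pairing form (DF-3) is ★
`AbelianVarietyWeilPairingRelFrobenius`).  ONE definition with body ((DF-1) `DualPair.frobeniusTwist`, the dual pair of
the Frobenius twist = ★ `DualPair.baseChange` along `Spec Frobᵐ`) + theorems; one `private` plumbing copy (`dualIsogeny_congr_aux`); no `Prop`-valued definition, no instance,
no notation, no `sorry`.

## Mathematics

Let `A` be an abelian variety over a field `k` of exponential characteristic `p`, `q = p^m`, `F_A : A → A^{(q)}` the
relative Frobenius (★ `AbelianVariety.relFrobenius`; `A^{(q)} = A ×_{k, Frobᵐ} k`, ★ `frobeniusTwist`), and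
`D = (Â, 𝒫)` a dual pair for `A` (★ `AbelianSchemeDualPair`) satisfying the unit hypothesis `𝒫|_{A × {ε}} ≅ 𝒪`.
**(DF-1)** The base change `D^{(q)} := D ×_{k,Frobᵐ} k = (Â^{(q)}, 𝒫^{(q)})` (★ `DualPair.baseChange`) is a dual pair for
`A^{(q)}`, and its dual abelian scheme IS the Frobenius twist of `Â` (all `rfl`: §1).  **(DF-2)** For the dual
homomorphism `(F_A)^∨ : Â^{(q)} → Â` (★ `dualIsogeny`, the morphism classifying `(F_A × 1)^*𝒫^{(q)}`):

  **`F_{Â} ≫ (F_A)^∨ = [q]_{Â}`**   (`relFrobenius_hat_comp_dualIsogeny_relFrobenius`).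

Proof ([MumfordAV1970] §15, proof of Thm. 1, with the Frobenius in place of `n_X`): both sides are `k`-morphisms
`Â → Â`, and by the universal property of `(Â, 𝒫)` (★ `DualPair.eq_of_nonempty_iso`) it suffices that both pull `𝒫`
back to `𝒫^{⊗q}` on `A × Â`.  For `[q]_{Â}` this is ★ (SYM-n) (`(1 × [q])^*𝒫 ≅ 𝒫^{⊗q}`, as in ★ `dualIsogeny_mulN`).  For
`F_{Â} ≫ (F_A)^∨`: `(1 × (F_{Â} ≫ F_A^∨))^*𝒫 ≅ (1 × F_{Â})^*(F_A × 1)^*𝒫^{(q)} = (F_A × F_{Â})^*pr^*𝒫`, and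
**`(F_A × F_{Â}) ≫ pr = F^{abs}_{A × Â}`** is the absolute `q`-Frobenius of `A ×_k Â` (§2, checked on the two projections:
`F_{X/k} ≫ pr_X = F_X^{abs}`, ★ `relFrobeniusOver_left_comp_fst`), which pulls every line bundle back to its `q`-th
tensor power (★ (FROB-PIC) `nonempty_pullback_absFrobeniusOver_iso_tensorPow`, Hartshorne IV 2.4.1).  Hence (§4), over a
perfect field of characteristic `p`, `(F_A)^∨` is a homomorphism `Â^{(q)} → Â` with `F_{Â} ≫ (F_A)^∨ = q • 𝟙`, so it IS
the Verschiebung of `Â` (★ `existsUnique_relFrobenius_comp_eq_pow_zsmul_id`: the unique `V` with `F ≫ V = [q]`):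

  **`(F_A)^∨ = V_{Â}`**   (`hom_eq_dualIsogenyOver_relFrobenius`, `toSchemeHom_verschiebung_eq_dualIsogeny_relFrobenius`).

Equivalently `F_A^∨ ∘ λ^{(q)} ∘ F_A = q·λ` for every homomorphism `λ : A → Â` (by ★ `relFrobenius_comp` naturality
`λ^{(q)} ∘ F_A = F_{Â} ∘ λ`): §3 `relFrobenius_comp_baseChangeHom_comp_dualIsogeny`.

## Contents
* §1 (DF-1): `toOver_ofAbelianVariety_frobeniusTwist` (`rfl`), **`DualPair.frobeniusTwist`** (`:= D.baseChange (frobSpec k p m)`),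
  `frobeniusTwist_hat`, `frobeniusTwist_hat_eq_toOver` (the dual of the twist is the twist of the dual, `rfl`), `frobeniusTwist_P`,
  `nonempty_unitHatSlice_frobeniusTwist_iso` (the unit hypothesis passes to `D^{(q)}`);
* §2 `baseChangeToProd_relFrobenius_comp_eq_absFrobeniusOver` (`(1 × F_{Â}) ≫ (F_A × 1) ≫ pr = F^{abs}_{A×Â}`),
  `nonempty_pullbackP_relFrobenius_comp_dualIsogeny_iso_tensorPow` (`(1 × (F_{Â} ≫ F_A^∨))^*𝒫 ≅ 𝒫^{⊗q}`),
  `nonempty_pullbackP_mulN_iso_tensorPow` (`(1 × [n])^*𝒫 ≅ 𝒫^{⊗n}`);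
* §3 (DF-2): **`relFrobenius_hat_comp_dualIsogeny_relFrobenius`** (+ `Over` form, + the form for an ARBITRARY dual pair
  `D′` of `A^{(q)}` through the transport `dualIsogeny (𝟙) D′ D^{(q)}`), `relFrobenius_comp_baseChangeHom_comp_dualIsogeny`
  (`F_A ≫ λ^{(q)} ≫ F_A^∨ = λ ≫ [q]`);
* §4 `isMonHom_dualIsogenyOver_relFrobenius`, **`hom_eq_dualIsogenyOver_relFrobenius`** (`F ≫ V = [q] ⟹ V = (F_A)^∨`),
  `toSchemeHom_verschiebung_eq_dualIsogeny_relFrobenius` (`(F_A)^∨ = V_{Â}` for the ★ Verschiebung `∃!`).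

HC_CM is proved only modulo the printed citations until rung 0 closes; this file changes no count.

## References
* [MumfordAV1970] D. Mumford, *Abelian Varieties* (1970), §15 Thm. 1 (p. 143) («`f^∨`», duality of `n_X`; the same
  seesaw argument for the Frobenius), §8 (iv) p. 75.
* [Oda1969] T. Oda, *The first de Rham cohomology group and Dieudonné modules*, Ann. Sci. ÉNS (4) 2 (1969), §1
  (Cor. 1.3: `F` and `V` adjoint under the Weil pairing; `F̂ = V`).
* [MilneAV2008] J. S. Milne, *Abelian Varieties* (2008), I §8 pp. 36–37, I §9 Thm. 9.1 (p. 42).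
* [Hartshorne1977] R. Hartshorne, *Algebraic Geometry*, IV §2 Rem. 2.4.1 (Frobenius pulls `𝒪(D)` back to `𝒪(D)^{⊗q}`).
-/

noncomputable section

universe u

open CategoryTheory CategoryTheory.Limits AlgebraicGeometry MonoidalCategory CartesianMonoidalCategory
open scoped MonObj

-- `Scheme.Modules` / `SheafOfModules` are not reducible (as in Mathlib's `AlgebraicGeometry/Modules/Sheaf.lean`).
set_option backward.isDefEq.respectTransparency false

namespace Literature.AlgebraicGeometry.AbelianSchemes

namespace AbelianSchemeOver

namespace DualPair

open Literature.AlgebraicGeometry.Motives Literature.AlgebraicGeometry.AbelianVarieties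
  Literature.AlgebraicGeometry.Modules

variable {k : Type u} [Field k] (p : ℕ) [ExpChar k p] (m : ℕ) (A : AbelianVariety k)

/-! ## §1 (DF-1) The dual pair of the Frobenius twist -/

/-- The abelian `k`-scheme of the Frobenius twist `A^{(q)}` IS the base change of the abelian `k`-scheme of `A` along
`Spec Frobᵐ` (definitional). [cite: MumfordFogartyKirwan1994, Ch. 6 §1 Cor. 6.8 (p. 118)] -/
theorem toOver_ofAbelianVariety_frobeniusTwist :
    (AbelianScheme.ofAbelianVariety (A.frobeniusTwist p m)).toOver =
      (AbelianScheme.ofAbelianVariety A).toOver.baseChange (frobSpec k p m) :=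
  rfl

variable (D : (AbelianScheme.ofAbelianVariety A).toOver.DualPair)

/-- **(DF-1) the dual pair `D^{(q)} = (Â^{(q)}, 𝒫^{(q)})` of the Frobenius twist `A^{(q)}`**: the base change of `D` along
`Spec Frobᵐ : Spec k → Spec k` (★ `DualPair.baseChange`: formation of the dual abelian scheme commutes with base change).
[cite: MumfordFogartyKirwan1994, Ch. 6 §1 Cor. 6.8 (p. 118)] -/
def frobeniusTwist : (AbelianScheme.ofAbelianVariety (A.frobeniusTwist p m)).toOver.DualPair :=
  D.baseChange (frobSpec k p m)

/-- `D^{(q)}` is `D.baseChange (Spec Frobᵐ)` (definitional). [cite: MumfordFogartyKirwan1994, Ch. 6 §1 Cor. 6.8 (p. 118)] -/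
theorem frobeniusTwist_eq_baseChange : D.frobeniusTwist p m A = D.baseChange (frobSpec k p m) := rfl

/-- The dual abelian scheme of `D^{(q)}` is `Â ×_{k,Frobᵐ} k` (definitional). [cite: MumfordFogartyKirwan1994, Ch. 6 §1 Cor. 6.8 (p. 118)] -/
theorem frobeniusTwist_hat : (D.frobeniusTwist p m A).hat = D.hat.baseChange (frobSpec k p m) := rfl

/-- **`(A^{(q)})^∧ = (Â)^{(q)}`**: the dual abelian scheme of `D^{(q)}` IS the abelian `k`-scheme of the Frobenius twist of
the abelian variety `Â` (definitional). [cite: MumfordAV1970, §15 Thm. 1 (p. 143)] -/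
theorem frobeniusTwist_hat_eq_toOver :
    (D.frobeniusTwist p m A).hat =
      (AbelianScheme.ofAbelianVariety ((D.hat.toAffine.toAbelianVariety).frobeniusTwist p m)).toOver :=
  rfl

/-- The Poincaré sheaf of `D^{(q)}` is the pull-back of `𝒫` along `A^{(q)} × Â^{(q)} → A × Â` (definitional).
[cite: MumfordFogartyKirwan1994, Ch. 6 §1 Cor. 6.8 (p. 118)] -/
theorem frobeniusTwist_P : (D.frobeniusTwist p m A).P = D.PBaseChange (frobSpec k p m) := rfl

/-- The unit hypothesis `𝒫|_{A × {ε}} ≅ 𝒪` passes to `D^{(q)}` (★ `nonempty_unitHatSlice_baseChange_iso`).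
[cite: MumfordFogartyKirwan1994, Ch. 6 §2 (p. 121)] -/
theorem nonempty_unitHatSlice_frobeniusTwist_iso
    (hD : Nonempty ((Scheme.Modules.pullback (unitHatSlice D)).obj D.P ≅ SheafOfModules.unit _)) :
    Nonempty ((Scheme.Modules.pullback (unitHatSlice (D.frobeniusTwist p m A))).obj (D.frobeniusTwist p m A).P ≅
      SheafOfModules.unit _) :=
  D.nonempty_unitHatSlice_baseChange_iso (g := frobSpec k p m) hD

/-! ## §2 `(1 × F_{Â}) ≫ (F_A × 1) ≫ pr = F^{abs}_{A × Â}`, hence `(1 × (F_{Â} ≫ F_A^∨))^*𝒫 ≅ 𝒫^{⊗q}` -/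

/-- Plumbing in any category: if `c ≫ d = c₁ ≫ t`, `b ≫ c₁ = b₁ ≫ s`, `a ≫ b₁ = a₁`, `s ≫ t = u` and `F ≫ d = a₁ ≫ u`,
then `(a ≫ b ≫ c) ≫ d = F ≫ d` (used to compare a three-fold composite with the Frobenius on each projection of a
fibre product, where `rw` is unavailable because the objects are only semireducibly equal). [cite: GortzWedhorn2020, Section (4.7)] -/
theorem comp_comp_comp_proj_eq {C : Type*} [Category C] {X₀ X₁ X₂ X₃ Y Y₁ Y₂ : C}
    {a : X₀ ⟶ X₁} {b : X₁ ⟶ X₂} {c : X₂ ⟶ X₃} {d : X₃ ⟶ Y} {c₁ : X₂ ⟶ Y₂} {t : Y₂ ⟶ Y} {b₁ : X₁ ⟶ Y₁}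
    {s : Y₁ ⟶ Y₂} {a₁ : X₀ ⟶ Y₁} {u : Y₁ ⟶ Y} {F : X₀ ⟶ X₃}
    (h1 : c ≫ d = c₁ ≫ t) (h2 : b ≫ c₁ = b₁ ≫ s) (h3 : a ≫ b₁ = a₁) (h5 : s ≫ t = u) (hR : F ≫ d = a₁ ≫ u) :
    (a ≫ b ≫ c) ≫ d = F ≫ d := by
  rw [hR, Category.assoc, Category.assoc, h1, reassoc_of% h2, reassoc_of% h3, h5]

/-- Variant of `comp_comp_comp_proj_eq` with the middle square degenerate (`b ≫ c₁ = b₁`) and the first one carrying the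
extra factor (`a ≫ b₁ = a₁ ≫ s`). [cite: GortzWedhorn2020, Section (4.7)] -/
theorem comp_comp_comp_proj_eq' {C : Type*} [Category C] {X₀ X₁ X₂ X₃ Y Y₁ Y₂ : C}
    {a : X₀ ⟶ X₁} {b : X₁ ⟶ X₂} {c : X₂ ⟶ X₃} {d : X₃ ⟶ Y} {c₁ : X₂ ⟶ Y₂} {t : Y₂ ⟶ Y} {b₁ : X₁ ⟶ Y₂}
    {a₁ : X₀ ⟶ Y₁} {s : Y₁ ⟶ Y₂} {u : Y₁ ⟶ Y} {F : X₀ ⟶ X₃}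
    (h1 : c ≫ d = c₁ ≫ t) (h2 : b ≫ c₁ = b₁) (h3 : a ≫ b₁ = a₁ ≫ s) (h5 : s ≫ t = u) (hR : F ≫ d = a₁ ≫ u) :
    (a ≫ b ≫ c) ≫ d = F ≫ d := by
  rw [hR, Category.assoc, Category.assoc, h1, reassoc_of% h2, reassoc_of% h3, h5]

/-- **`(1_A × F_{Â}) ≫ (F_A × 1_{Â^{(q)}}) ≫ (A^{(q)} × Â^{(q)} → A × Â) = F^{abs}_{A ×_k Â}`**: the relative Frobenii of
the two factors followed by the projection of the twist give the absolute `q`-Frobenius of `A ×_k Â` (checked on the two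
projections with ★ `relFrobeniusOver_left_comp_fst`, `F_{X/k} ≫ pr_X = F_X^{abs}`, and the naturality ★ `powEndo_comp`).
[cite: Hartshorne1977, IV §2 Rem. 2.4.1] -/
theorem baseChangeToProd_relFrobenius_comp_eq_absFrobeniusOver :
    (AbelianScheme.ofAbelianVariety A).toOver.baseChangeToProd (D.frobeniusTwist p m A).hat D.hat.X.hom
        (relFrobeniusOver p m D.hat.X).left (Over.w _) ≫
      (baseChangeHom (A := (AbelianScheme.ofAbelianVariety A).toOver)
          (B := (AbelianScheme.ofAbelianVariety (A.frobeniusTwist p m)).toOver)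
          (relFrobeniusOver p m A.X) (D.frobeniusTwist p m A).hat.X.hom).left ≫
      D.prodBaseChangeToProd (frobSpec k p m) =
    absFrobeniusOver p m (Over.mk (pullback.fst A.X.hom D.hat.X.hom ≫ A.X.hom)) := by
  apply pullback.hom_ext
  · -- first projections: both sides are `pr_A ≫ F_A^{abs}`
    have hR : absFrobeniusOver p m (Over.mk (pullback.fst A.X.hom D.hat.X.hom ≫ A.X.hom)) ≫
        pullback.fst A.X.hom D.hat.X.hom = pullback.fst A.X.hom D.hat.X.hom ≫ absFrobeniusOver p m A.X :=
      powEndo_comp _ _ _ _ (add_pow_expChar_pow_sections p m A.X)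
    have h1 : D.prodBaseChangeToProd (frobSpec k p m) ≫ pullback.fst A.X.hom D.hat.X.hom =
        pullback.fst (AbelianScheme.ofAbelianVariety (A.frobeniusTwist p m)).toOver.X.hom
            (D.frobeniusTwist p m A).hat.X.hom ≫ twistFst p m A.X :=
      D.prodBaseChangeToProd_fst (frobSpec k p m)
    have h2 : (baseChangeHom (A := (AbelianScheme.ofAbelianVariety A).toOver)
          (B := (AbelianScheme.ofAbelianVariety (A.frobeniusTwist p m)).toOver)
          (relFrobeniusOver p m A.X) (D.frobeniusTwist p m A).hat.X.hom).left ≫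
        pullback.fst (AbelianScheme.ofAbelianVariety (A.frobeniusTwist p m)).toOver.X.hom
          (D.frobeniusTwist p m A).hat.X.hom =
        pullback.fst A.X.hom (D.frobeniusTwist p m A).hat.X.hom ≫ (relFrobeniusOver p m A.X).left :=
      baseChangeHom_left_comp_fst _ _
    have h3 : (AbelianScheme.ofAbelianVariety A).toOver.baseChangeToProd (D.frobeniusTwist p m A).hat D.hat.X.hom
          (relFrobeniusOver p m D.hat.X).left (Over.w _) ≫ pullback.fst A.X.hom (D.frobeniusTwist p m A).hat.X.hom =
        pullback.fst A.X.hom D.hat.X.hom :=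
      baseChangeToProd_fst _ _ _ _ _
    exact comp_comp_comp_proj_eq h1 h2 h3 (relFrobeniusOver_left_comp_fst p m A.X) hR
  · -- second projections: both sides are `pr_Â ≫ F_Â^{abs}`
    have hR : absFrobeniusOver p m (Over.mk (pullback.fst A.X.hom D.hat.X.hom ≫ A.X.hom)) ≫
        pullback.snd A.X.hom D.hat.X.hom = pullback.snd A.X.hom D.hat.X.hom ≫ absFrobeniusOver p m D.hat.X :=
      powEndo_comp _ _ _ _ (add_pow_expChar_pow_sections p m D.hat.X)
    have h1 : D.prodBaseChangeToProd (frobSpec k p m) ≫ pullback.snd A.X.hom D.hat.X.hom =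
        pullback.snd (AbelianScheme.ofAbelianVariety (A.frobeniusTwist p m)).toOver.X.hom
            (D.frobeniusTwist p m A).hat.X.hom ≫ twistFst p m D.hat.X :=
      D.prodBaseChangeToProd_snd (frobSpec k p m)
    have h2 : (baseChangeHom (A := (AbelianScheme.ofAbelianVariety A).toOver)
          (B := (AbelianScheme.ofAbelianVariety (A.frobeniusTwist p m)).toOver)
          (relFrobeniusOver p m A.X) (D.frobeniusTwist p m A).hat.X.hom).left ≫
        pullback.snd (AbelianScheme.ofAbelianVariety (A.frobeniusTwist p m)).toOver.X.hom
          (D.frobeniusTwist p m A).hat.X.hom =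
        pullback.snd A.X.hom (D.frobeniusTwist p m A).hat.X.hom :=
      Over.w _
    have h3 : (AbelianScheme.ofAbelianVariety A).toOver.baseChangeToProd (D.frobeniusTwist p m A).hat D.hat.X.hom
          (relFrobeniusOver p m D.hat.X).left (Over.w _) ≫ pullback.snd A.X.hom (D.frobeniusTwist p m A).hat.X.hom =
        pullback.snd A.X.hom D.hat.X.hom ≫ (relFrobeniusOver p m D.hat.X).left :=
      baseChangeToProd_snd _ _ _ _ _
    exact comp_comp_comp_proj_eq' h1 h2 h3 (relFrobeniusOver_left_comp_fst p m D.hat.X) hR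

/-- **`(1 × (F_{Â} ≫ F_A^∨))^*𝒫 ≅ 𝒫^{⊗q}`** on `A ×_k Â`: `(1 × F_A^∨)^*𝒫 ≅ (F_A × 1)^*𝒫^{(q)}` (★ `nonempty_pullbackP_dualIsogeny_iso`),
§2's identification of `(1 × F_Â) ≫ (F_A × 1) ≫ pr` with the absolute Frobenius, and ★ (FROB-PIC) `F^{abs,*}𝒫 ≅ 𝒫^{⊗q}`.
[cite: MumfordAV1970, §15 Thm. 1 (p. 143)] [cite: Hartshorne1977, IV §2 Rem. 2.4.1] -/
theorem nonempty_pullbackP_relFrobenius_comp_dualIsogeny_iso_tensorPow :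
    Nonempty (D.pullbackP D.hat.X.hom
        ((relFrobeniusOver p m D.hat.X).left ≫
          dualIsogeny (A' := (AbelianScheme.ofAbelianVariety A).toOver)
            (B := (AbelianScheme.ofAbelianVariety (A.frobeniusTwist p m)).toOver)
            (A.relFrobenius p m).hom.hom.hom D (D.frobeniusTwist p m A))
        (by rw [Category.assoc, dualIsogeny_comp_hom]; exact Over.w _) ≅
      tensorPow D.P (p ^ m)) := by
  have hfac := baseChangeToProd_comp (A := (AbelianScheme.ofAbelianVariety A).toOver) (B := D.hat)
    (B' := (D.frobeniusTwist p m A).hat) D.hat.X.hom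
    (relFrobeniusOver p m D.hat.X).left
    (dualIsogeny (A' := (AbelianScheme.ofAbelianVariety A).toOver)
      (B := (AbelianScheme.ofAbelianVariety (A.frobeniusTwist p m)).toOver)
      (A.relFrobenius p m).hom.hom.hom D (D.frobeniusTwist p m A))
    (Over.w _) (dualIsogeny_comp_hom _ _ _)
  obtain ⟨eF⟩ := nonempty_pullbackP_dualIsogeny_iso (A' := (AbelianScheme.ofAbelianVariety A).toOver)
    (B := (AbelianScheme.ofAbelianVariety (A.frobeniusTwist p m)).toOver)
    (A.relFrobenius p m).hom.hom.hom D (D.frobeniusTwist p m A)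
  have hΦ := baseChangeToProd_relFrobenius_comp_eq_absFrobeniusOver p m A D
  obtain ⟨eP⟩ := nonempty_pullback_absFrobeniusOver_iso_tensorPow p m
    (Over.mk (pullback.fst A.X.hom D.hat.X.hom ≫ A.X.hom)) D.hasRank_one (HasRank.isFiniteLocallyFree' D.hasRank_one)
  unfold pullbackP
  refine ⟨(Scheme.Modules.pullbackCongr hfac).app _ ≪≫ ((Scheme.Modules.pullbackComp _ _).app _).symm ≪≫
    (Scheme.Modules.pullback _).mapIso eF ≪≫ (Scheme.Modules.pullbackComp _ _).app _ ≪≫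
    (Scheme.Modules.pullbackComp _ _).app D.P ≪≫
    (Scheme.Modules.pullbackCongr ((Category.assoc _ _ _).trans hΦ)).app _ ≪≫ eP⟩

/-- **`(1 × [n]_{Â})^*𝒫 ≅ 𝒫^{⊗n}`** on `A ×_k Â` (★ (SYM-n) `nonempty_pullbackP_pow_iso_tensorPow` + ★ `nonempty_pullbackP_id_iso`,
the computation inside ★ `dualIsogeny_mulN`). [cite: MumfordAV1970, §8 ((iv), p. 75) and §15 Thm. 1 (p. 143)] -/
theorem nonempty_pullbackP_mulN_iso_tensorPow
    (hD : Nonempty ((Scheme.Modules.pullback (unitHatSlice D)).obj D.P ≅ SheafOfModules.unit _)) (n : ℕ) :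
    Nonempty (D.pullbackP D.hat.X.hom (D.hat.mulN n).left (Over.w _) ≅ tensorPow D.P n) := by
  obtain ⟨e₂⟩ := D.nonempty_pullbackP_pow_iso_tensorPow hD D.hat.X.hom (𝟙 D.hat.X : Over.mk D.hat.X.hom ⟶ D.hat.X) n
  obtain ⟨e₃⟩ := nonempty_pullbackP_id_iso D
  obtain ⟨e₄⟩ := nonempty_tensorPow_iso_of_iso e₃ n
  have hc : D.pullbackP D.hat.X.hom (D.hat.mulN n).left (Over.w _) =
      D.pullbackP D.hat.X.hom (((𝟙 D.hat.X : Over.mk D.hat.X.hom ⟶ D.hat.X)) ^ n).left (Over.w _) :=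
    D.pullbackP_congr _ rfl _ _
  rw [hc]
  exact ⟨e₂ ≪≫ e₄⟩

/-! ## §3 (DF-2) `F_{Â} ≫ (F_A)^∨ = [q]_{Â}` -/

/-- **(DF-2) THE DUAL OF THE FROBENIUS IS THE VERSCHIEBUNG, `[q]`-form: `F_{Â} ≫ (F_A)^∨ = [q]_{Â}`** as morphisms
`Â → Â`, for a dual pair `D = (Â, 𝒫)` of `A` with the unit hypothesis and the dual pair `D^{(q)}` of `A^{(q)}` (§1): both
sides pull `𝒫` back to `𝒫^{⊗q}` (§2), so they agree by the universal property (★ `eq_of_nonempty_iso` on the family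
`𝒫^{⊗q}`, ★ `exists_tensorPow_family`). [cite: MumfordAV1970, §15 Thm. 1 (p. 143)] [cite: Oda1969, §1 Cor. 1.3] -/
theorem relFrobenius_hat_comp_dualIsogeny_relFrobenius
    (hD : Nonempty ((Scheme.Modules.pullback (unitHatSlice D)).obj D.P ≅ SheafOfModules.unit _)) :
    (relFrobeniusOver p m D.hat.X).left ≫
        dualIsogeny (A' := (AbelianScheme.ofAbelianVariety A).toOver)
          (B := (AbelianScheme.ofAbelianVariety (A.frobeniusTwist p m)).toOver)
          (A.relFrobenius p m).hom.hom.hom D (D.frobeniusTwist p m A) =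
      (D.hat.mulN (p ^ m)).left := by
  obtain ⟨ℒ, hℒL, hℒ⟩ := D.exists_tensorPow_family (p ^ m)
  refine D.eq_of_nonempty_iso D.hat.X.hom ℒ hℒ _ _ (by rw [Category.assoc, dualIsogeny_comp_hom]; exact Over.w _)
    (Over.w _) ?_ ?_
  · rw [hℒL]
    exact nonempty_pullbackP_relFrobenius_comp_dualIsogeny_iso_tensorPow p m A D
  · rw [hℒL]
    exact nonempty_pullbackP_mulN_iso_tensorPow A D hD (p ^ m)

/-- (DF-2) in `Over (Spec k)`: `F_{Â} ≫ (F_A)^∨ = [q]_{Â}`. [cite: MumfordAV1970, §15 Thm. 1 (p. 143)] -/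
theorem relFrobenius_hat_comp_dualIsogenyOver_relFrobenius
    (hD : Nonempty ((Scheme.Modules.pullback (unitHatSlice D)).obj D.P ≅ SheafOfModules.unit _)) :
    relFrobeniusOver p m D.hat.X ≫
        dualIsogenyOver (A' := (AbelianScheme.ofAbelianVariety A).toOver)
          (B := (AbelianScheme.ofAbelianVariety (A.frobeniusTwist p m)).toOver)
          (A.relFrobenius p m).hom.hom.hom D (D.frobeniusTwist p m A) =
      D.hat.mulN (p ^ m) :=
  Over.OverMorphism.ext (by
    rw [Over.comp_left, dualIsogenyOver_left]
    exact relFrobenius_hat_comp_dualIsogeny_relFrobenius p m A D hD)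

/-- `dualIsogeny` depends only on the homomorphism (a `private` copy of ★ `DualPair.dualIsogeny_congr` of
`AbelianSchemeQuotientPolarizationPullback`, not imported to keep the quotient apparatus out of the cone).
[cite: MilneAV2008, I §9 Thm. 9.1 (p. 42)] -/
private theorem dualIsogeny_congr_aux {S : Scheme.{u}} {A' B : AbelianSchemeOver S} {ψ ψ' : A'.X ⟶ B.X} [IsMonHom ψ] [IsMonHom ψ']
    (h : ψ = ψ') (D' : A'.DualPair) (DB : B.DualPair) : dualIsogeny ψ D' DB = dualIsogeny ψ' D' DB := by
  subst h
  rfl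

/-- **(DF-2) for an ARBITRARY dual pair `D′` of `A^{(q)}`**: `F_{Â} ≫ τ ≫ (F_A)^∨_{D,D′} = [q]_{Â}`, where
`τ = (𝟙_{A^{(q)}})^∨_{D′,D^{(q)}} : Â^{(q)} → D′.hat` is the transport between the two dual pairs of `A^{(q)}` (★ `dualIsogeny`
of the identity) and `(F_A)^∨_{D,D′} : D′.hat → Â` the dual homomorphism read in `D′` — so HEART∕ST-0′ can plug any given
dual pair of the twist (★ `dualIsogeny_comp`, ★ `dualIsogeny_congr`). [cite: MumfordAV1970, §15 Thm. 1 (p. 143)] -/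
theorem relFrobenius_hat_comp_dualIsogeny_id_comp_dualIsogeny_relFrobenius
    (hD : Nonempty ((Scheme.Modules.pullback (unitHatSlice D)).obj D.P ≅ SheafOfModules.unit _))
    (D' : (AbelianScheme.ofAbelianVariety (A.frobeniusTwist p m)).toOver.DualPair) :
    (relFrobeniusOver p m D.hat.X).left ≫
        dualIsogeny (𝟙 (AbelianScheme.ofAbelianVariety (A.frobeniusTwist p m)).toOver.X) D' (D.frobeniusTwist p m A) ≫
        dualIsogeny (A' := (AbelianScheme.ofAbelianVariety A).toOver)
          (B := (AbelianScheme.ofAbelianVariety (A.frobeniusTwist p m)).toOver)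
          (A.relFrobenius p m).hom.hom.hom D D' =
      (D.hat.mulN (p ^ m)).left := by
  rw [← dualIsogeny_comp (A.relFrobenius p m).hom.hom.hom (𝟙 _) D D' (D.frobeniusTwist p m A),
    dualIsogeny_congr_aux (Category.comp_id _) D (D.frobeniusTwist p m A)]
  exact relFrobenius_hat_comp_dualIsogeny_relFrobenius p m A D hD

/-- **`F_A ≫ λ^{(q)} ≫ (F_A)^∨ = λ ≫ [q]_{Â}`, i.e. `F^*λ^{(q)} = q·λ`** for every homomorphism `λ : A → Â` over `k`
(a polarization, say), `λ^{(q)} = λ ×_k Frobᵐ : A^{(q)} → Â^{(q)}` its base change: the naturality of the relative Frobenius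
`F_A ≫ λ^{(q)} = λ ≫ F_{Â}` (★ `relFrobeniusOver_comp_map`) and (DF-2). [cite: MumfordAV1970, §15 Thm. 1 (p. 143)]
[cite: Oda1969, §1 Cor. 1.3] -/
theorem relFrobenius_comp_baseChangeHom_comp_dualIsogeny
    (hD : Nonempty ((Scheme.Modules.pullback (unitHatSlice D)).obj D.P ≅ SheafOfModules.unit _))
    (lam : A.X ⟶ D.hat.X) :
    (relFrobeniusOver p m A.X).left ≫
        (baseChangeHom (A := (AbelianScheme.ofAbelianVariety A).toOver) (B := D.hat) lam (frobSpec k p m)).left ≫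
        dualIsogeny (A' := (AbelianScheme.ofAbelianVariety A).toOver)
          (B := (AbelianScheme.ofAbelianVariety (A.frobeniusTwist p m)).toOver)
          (A.relFrobenius p m).hom.hom.hom D (D.frobeniusTwist p m A) =
      lam.left ≫ (D.hat.mulN (p ^ m)).left := by
  have hnat : relFrobeniusOver p m A.X ≫
        baseChangeHom (A := (AbelianScheme.ofAbelianVariety A).toOver) (B := D.hat) lam (frobSpec k p m) =
      lam ≫ relFrobeniusOver p m D.hat.X :=
    relFrobeniusOver_comp_map p m lam
  rw [← Category.assoc, ← Over.comp_left, hnat, Over.comp_left, Category.assoc,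
    relFrobenius_hat_comp_dualIsogeny_relFrobenius p m A D hD]

/-! ## §4 `(F_A)^∨ = V_{Â}` -/

/-- `(F_A)^∨ : Â^{(q)} → Â` is a homomorphism of group schemes (★ `isMonHom_dualIsogenyOver` over the reduced base `Spec k`,
the unit hypothesis passing to `D^{(q)}` by §1). [cite: MumfordFogartyKirwan1994, Ch. 6 §1 Corollary 6.4 (p. 117)] -/
theorem isMonHom_dualIsogenyOver_relFrobenius
    (hD : Nonempty ((Scheme.Modules.pullback (unitHatSlice D)).obj D.P ≅ SheafOfModules.unit _)) :
    IsMonHom (dualIsogenyOver (A' := (AbelianScheme.ofAbelianVariety A).toOver)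
      (B := (AbelianScheme.ofAbelianVariety (A.frobeniusTwist p m)).toOver)
      (A.relFrobenius p m).hom.hom.hom D (D.frobeniusTwist p m A)) :=
  isMonHom_dualIsogenyOver _ D (D.frobeniusTwist p m A) (D.nonempty_unitHatSlice_frobeniusTwist_iso p m A hD) hD

/-- **`(F_A)^∨ = V_{Â}` (uniqueness form)**: any homomorphism of abelian varieties `V : Â^{(q)} → Â` with
`F_{Â} ≫ V = q • 𝟙` has underlying `k`-morphism `(F_A)^∨` — because `(F_A)^∨` is such a homomorphism ((DF-2), §3) and the
factorisation of `[q]` through the faithfully flat `F_{Â}` is unique (★ `existsUnique_relFrobenius_comp_eq_pow_zsmul_id`).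
Over a perfect field of characteristic `p` the Verschiebung `V_{Â}` exists (ibid.), so this says `(F_A)^∨ = V_{Â}`.
[cite: MumfordAV1970, §15 Thm. 1 (p. 143)] [cite: EdixhovenVanDerGeerMoonenAV, Ch. 5 §2 (Verschiebung, `V ∘ F = [p]`), (5.21)] -/
theorem hom_eq_dualIsogenyOver_relFrobenius [PerfectField k] [Fact p.Prime] [CharP k p]
    (hD : Nonempty ((Scheme.Modules.pullback (unitHatSlice D)).obj D.P ≅ SheafOfModules.unit _))
    (V : (D.hat.toAffine.toAbelianVariety).frobeniusTwist p m ⟶ D.hat.toAffine.toAbelianVariety)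
    (hV : (D.hat.toAffine.toAbelianVariety).relFrobenius p m ≫ V = ((p ^ m : ℕ) : ℤ) • 𝟙 _) :
    V.hom.hom.hom =
      dualIsogenyOver (A' := (AbelianScheme.ofAbelianVariety A).toOver)
        (B := (AbelianScheme.ofAbelianVariety (A.frobeniusTwist p m)).toOver)
        (A.relFrobenius p m).hom.hom.hom D (D.frobeniusTwist p m A) := by
  haveI := D.isMonHom_dualIsogenyOver_relFrobenius p m A hD
  -- `(F_A)^∨` as a morphism of abelian varieties `Â^{(q)} ⟶ Â`
  let V' : (D.hat.toAffine.toAbelianVariety).frobeniusTwist p m ⟶ D.hat.toAffine.toAbelianVariety :=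
    InducedCategory.homMk (Grp.homMk
      (A := ((D.hat.toAffine.toAbelianVariety).frobeniusTwist p m).toGrp) (B := (D.hat.toAffine.toAbelianVariety).toGrp)
      (dualIsogenyOver (A' := (AbelianScheme.ofAbelianVariety A).toOver)
        (B := (AbelianScheme.ofAbelianVariety (A.frobeniusTwist p m)).toOver)
        (A.relFrobenius p m).hom.hom.hom D (D.frobeniusTwist p m A)))
  have hV' : (D.hat.toAffine.toAbelianVariety).relFrobenius p m ≫ V' = ((p ^ m : ℕ) : ℤ) • 𝟙 _ := by
    refine AbelianVariety.hom_ext _ _ ?_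
    rw [AbelianVariety.comp_hom, AbelianVariety.hom_zsmul_id, zpow_natCast]
    exact relFrobenius_hat_comp_dualIsogenyOver_relFrobenius p m A D hD
  have huniq := ((D.hat.toAffine.toAbelianVariety).existsUnique_relFrobenius_comp_eq_pow_zsmul_id p m).unique hV hV'
  rw [huniq]
  rfl

/-- **`(F_A)^∨ = V_{Â}`** for THE Verschiebung of `Â`, i.e. the unique `V` of ★ `existsUnique_relFrobenius_comp_eq_pow_zsmul_id`
(`F_{Â} ≫ V = [q]`): its underlying `k`-morphism is the dual homomorphism of `F_A`. [cite: MumfordAV1970, §15 Thm. 1 (p. 143)]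
[cite: Oda1969, §1 Cor. 1.3] -/
theorem toSchemeHom_verschiebung_eq_dualIsogeny_relFrobenius [PerfectField k] [Fact p.Prime] [CharP k p]
    (hD : Nonempty ((Scheme.Modules.pullback (unitHatSlice D)).obj D.P ≅ SheafOfModules.unit _)) :
    AbelianVariety.Hom.toSchemeHom
        ((D.hat.toAffine.toAbelianVariety).existsUnique_relFrobenius_comp_eq_pow_zsmul_id p m).exists.choose =
      dualIsogeny (A' := (AbelianScheme.ofAbelianVariety A).toOver)
        (B := (AbelianScheme.ofAbelianVariety (A.frobeniusTwist p m)).toOver)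
        (A.relFrobenius p m).hom.hom.hom D (D.frobeniusTwist p m A) := by
  have h := D.hom_eq_dualIsogenyOver_relFrobenius p m A hD _
    ((D.hat.toAffine.toAbelianVariety).existsUnique_relFrobenius_comp_eq_pow_zsmul_id p m).exists.choose_spec
  exact (congrArg (fun f => Over.Hom.left f) h).trans (dualIsogenyOver_left _ _ _)

end DualPair

end AbelianSchemeOver

end Literature.AlgebraicGeometry.AbelianSchemes

end
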